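import Summits.BirchSwinnertonDyer.BirchSwinnertonDyer.Theorems.ResidualThetaTransportAtTwoThetaLayerLambdaCongruenceAtTwoHeckeAdjointJordanFinite
import HarnessLib

/-!
# Crux `ThetaLayerLambdaCongruenceAtTwo` (stmt-BirchSwinnertonDyer-20688, route ResidualThetaTransportAtTwo), line
# `birth` v14 — SD floor, kernel road, Hecke clause of IP, brick HA5c «κ HAS FINITE SUPPORT»: for the re-expansion `g₀·P` of a
# generalised edge `C = g₀·(u v; 0 w)` (brick HA4) the Jordan correction `κ_C(A) = Σ_{f∈g₀P} G₁(f⁻¹A) − F(adj(C)·A)` vanishes for all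
# but finitely many `A ∈ SL₂(ℤ)` (width seat bsd-wall-rtt-p3-w3 g11; `--supports stmt-BirchSwinnertonDyer-20688 --as helper`; closes nothing)

HONEST FRAMING. Elementary THEOREMS about `2×2` integer matrices and lists; no definition; nothing about any curve or form is asserted;
BSD is not proved by any of this.

WHAT (memo `Cruxes/ThetaLayerLambdaCongruenceAtTwo/Lines/birth-sd2-hecke-adjoint.md`, step (E)). Transport of the sequence-level
discrete Jordan lemma (`…HeckeAdjointJordanSeq/Finite`: `jordan_box`) to matrices: with `A' = g₀⁻¹A = (a b; c e)` one has
`f_j⁻¹A' = (−s_{j+1} −t_{j+1}; s_j t_j)` for `f_j = [P_j | P_{j+1}]` (`inv_edge_mul_entries`) and `adj(u v; 0 w)·A' = (−d s_m, −d t_m; u s_0, u t_0)`,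
so `G₁(f_j⁻¹A') = Φ(j, j+1)` (via `flagSide_coe_eq_side`) and `F(adj(C)A) = Φ(0, m)` (positive row scalings do not change the flag side,
`flagSide_rowScale`). Hence `κ_C(A) ≠ 0` puts `g₀⁻¹A` in the box of `jordan_box`, and `{A : κ_C(A) ≠ 0}` is finite (`finite_kappa_support`) —
the finiteness behind the κ-cancellation of brick HA6.

References: [Merel1995Homologie] §1.2; [Manin1972] §1.5.
-/

set_option autoImplicit false

noncomputable section

-- justification: the `Summit.BirchSwinnertonDyer.BirchSwinnertonDyer.…` path repeats a component (route-file convention)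
set_option linter.dupNamespace false

open scoped Classical MatrixGroups

open CongruenceSubgroup Matrix.SpecialLinearGroup ModularGroup
open Literature.NumberTheory.EllipticCurves.ModularForms

namespace Summit.BirchSwinnertonDyer.BirchSwinnertonDyer.Theorems.ThetaLayerLambdaCongruenceAtTwo

section KappaFinite

/-- **Row scaling**: multiplying the two rows of a matrix by positive integers does not change the flag side (all three keys scale by
the same positive factor). [folklore] -/
theorem flagSide_rowScale (l n a b c d : ℤ) (hl : 0 < l) (hn : 0 < n) :
    (if (0 < (l * a) * (n * c) ∨ ((l * a) * (n * c) = 0 ∧ (0 < (l * a + 2 * (l * b)) * (n * c + 2 * (n * d)) ∨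
        ((l * a + 2 * (l * b)) * (n * c + 2 * (n * d)) = 0 ∧ 0 < (l * a) * (n * d) + (l * b) * (n * c))))) then (1 : ℤ) else 0) =
    (if (0 < a * c ∨ (a * c = 0 ∧ (0 < (a + 2 * b) * (c + 2 * d) ∨
        ((a + 2 * b) * (c + 2 * d) = 0 ∧ 0 < a * d + b * c)))) then (1 : ℤ) else 0) := by
  have hln : 0 < l * n := mul_pos hl hn
  have e1 : (l * a) * (n * c) = (l * n) * (a * c) := by ring
  have e2 : (l * a + 2 * (l * b)) * (n * c + 2 * (n * d)) = (l * n) * ((a + 2 * b) * (c + 2 * d)) := by ring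
  have e3 : (l * a) * (n * d) + (l * b) * (n * c) = (l * n) * (a * d + b * c) := by ring
  rw [e1, e2, e3]
  have m1 : ∀ z : ℤ, 0 < (l * n) * z ↔ 0 < z := fun z ↦ by
    constructor
    · intro h; by_contra hz; push Not at hz; nlinarith
    · intro h; positivity
  have m2 : ∀ z : ℤ, (l * n) * z = 0 ↔ z = 0 := fun z ↦ by rw [mul_eq_zero, or_iff_right hln.ne']
  simp only [m1, m2]

/-- **Entries of `f⁻¹A'` for an edge matrix `f = [P_j | P_{j+1}]`**: `(−s_{j+1}, −t_{j+1}; s_j, t_j)` with `s_j = x_j c − y_j a`,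
`t_j = x_j e − y_j b` for `A' = (a b; c e)`. [folklore] -/
theorem inv_edge_mul_entries (f A : SL(2, ℤ)) (x₀ x₁ y₀ y₁ : ℤ) (hf : (f : Matrix (Fin 2) (Fin 2) ℤ) = !![x₀, x₁; y₀, y₁]) :
    (f⁻¹ * A) 0 0 = -(x₁ * A 1 0 - y₁ * A 0 0) ∧ (f⁻¹ * A) 0 1 = -(x₁ * A 1 1 - y₁ * A 0 1) ∧
      (f⁻¹ * A) 1 0 = x₀ * A 1 0 - y₀ * A 0 0 ∧ (f⁻¹ * A) 1 1 = x₀ * A 1 1 - y₀ * A 0 1 := by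
  have hinv : ((f⁻¹ : SL(2, ℤ)) : Matrix (Fin 2) (Fin 2) ℤ) = !![y₁, -x₁; -y₀, x₀] := by
    rw [Matrix.SpecialLinearGroup.coe_inv, hf, Matrix.adjugate_fin_two_of]
  refine ⟨?_, ?_, ?_, ?_⟩ <;>
  · rw [Matrix.SpecialLinearGroup.coe_mul, hinv]; simp [Matrix.mul_apply, Fin.sum_univ_two]; ring

/-- **`κ` has finite support (brick HA5c).** For the re-expansion data of a generalised edge `C = g₀·(u v; 0 w)` (`exists_reexpansion`:
convex chain `(x, y)`, edge list `P`, `(v,w) = d·P_m`), the set of `A ∈ SL₂(ℤ)` with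
`Σ_{f ∈ g₀P} G₁(f⁻¹A) ≠ F(adj(C)·A)` is finite. [cite: Merel1995Homologie, §1.2] -/
theorem finite_kappa_support (g₀ : SL(2, ℤ)) (u v w d : ℤ) (m : ℕ) (x y : ℕ → ℤ) (P : List SL(2, ℤ))
    (hu : 0 < u) (hd : 0 < d) (hm : 1 ≤ m) (hx0 : x 0 = 1) (hy0 : y 0 = 0)
    (hypos : ∀ j, 1 ≤ j → j ≤ m → 0 < y j) (hdet : ∀ j, j < m → x j * y (j + 1) - x (j + 1) * y j = 1)
    (hvd : v = d * x m) (hwd : w = d * y m) (hlen : P.length = m)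
    (hget : ∀ (j : ℕ) (hj : j < P.length), ((P[j] : SL(2, ℤ)) : Matrix (Fin 2) (Fin 2) ℤ) = !![x j, x (j + 1); y j, y (j + 1)]) :
    {A : SL(2, ℤ) |
      ((P.map fun f ↦ g₀ * f).map fun f ↦ (if (0 < (f⁻¹ * A) 0 0 * (f⁻¹ * A) 1 0 ∨ 0 < (f⁻¹ * A) 0 1 * (f⁻¹ * A) 1 1 ∨ 0 < ((f⁻¹ * A) 0 0 + (f⁻¹ * A) 0 1) * ((f⁻¹ * A) 1 0 + (f⁻¹ * A) 1 1)) then (1 : ℤ) else 0)).sum -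
        (if (0 < (((g₀ : Matrix (Fin 2) (Fin 2) ℤ) * !![u, v; 0, w]).adjugate * (A : Matrix (Fin 2) (Fin 2) ℤ)) 0 0 * (((g₀ : Matrix (Fin 2) (Fin 2) ℤ) * !![u, v; 0, w]).adjugate * (A : Matrix (Fin 2) (Fin 2) ℤ)) 1 0 ∨ ((((g₀ : Matrix (Fin 2) (Fin 2) ℤ) * !![u, v; 0, w]).adjugate * (A : Matrix (Fin 2) (Fin 2) ℤ)) 0 0 * (((g₀ : Matrix (Fin 2) (Fin 2) ℤ) * !![u, v; 0, w]).adjugate * (A : Matrix (Fin 2) (Fin 2) ℤ)) 1 0 = 0 ∧ (0 < ((((g₀ : Matrix (Fin 2) (Fin 2) ℤ) * !![u, v; 0, w]).adjugate * (A : Matrix (Fin 2) (Fin 2) ℤ)) 0 0 + 2 * (((g₀ : Matrix (Fin 2) (Fin 2) ℤ) * !![u, v; 0, w]).adjugate * (A : Matrix (Fin 2) (Fin 2) ℤ)) 0 1) * ((((g₀ : Matrix (Fin 2) (Fin 2) ℤ) * !![u, v; 0, w]).adjugate * (A : Matrix (Fin 2) (Fin 2) ℤ)) 1 0 + 2 *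 (((g₀ : Matrix (Fin 2) (Fin 2) ℤ) * !![u, v; 0, w]).adjugate * (A : Matrix (Fin 2) (Fin 2) ℤ)) 1 1) ∨
          (((((g₀ : Matrix (Fin 2) (Fin 2) ℤ) * !![u, v; 0, w]).adjugate * (A : Matrix (Fin 2) (Fin 2) ℤ)) 0 0 + 2 * (((g₀ : Matrix (Fin 2) (Fin 2) ℤ) * !![u, v; 0, w]).adjugate * (A : Matrix (Fin 2) (Fin 2) ℤ)) 0 1) * ((((g₀ : Matrix (Fin 2) (Fin 2) ℤ) * !![u, v; 0, w]).adjugate * (A : Matrix (Fin 2) (Fin 2) ℤ)) 1 0 + 2 * (((g₀ : Matrix (Fin 2) (Fin 2) ℤ) * !![u, v; 0, w]).adjugate * (A : Matrix (Fin 2) (Fin 2) ℤ)) 1 1) = 0 ∧ 0 < (((g₀ : Matrix (Fin 2) (Fin 2) ℤ) * !![u, v; 0, w]).adjugate * (A : Matrix (Fin 2) (Fin 2) ℤ)) 0 0 * (((g₀ : Matrix (Fin 2) (Fin 2) ℤ) * !![u, v; 0, w]).adjugate * (A : Matrix (Fin 2) (Fin 2) ℤ)) 1 1 + (((g₀ :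 Matrix (Fin 2) (Fin 2) ℤ) * !![u, v; 0, w]).adjugate * (A : Matrix (Fin 2) (Fin 2) ℤ)) 0 1 * (((g₀ : Matrix (Fin 2) (Fin 2) ℤ) * !![u, v; 0, w]).adjugate * (A : Matrix (Fin 2) (Fin 2) ℤ)) 1 0)))) then (1 : ℤ) else 0) ≠ 0}.Finite := by
  -- the box of `jordan_box`, transported by `g₀`
  set Bnd : ℤ := 3 * (1 + ∑ j ∈ Finset.range (m + 1), (|x j| + |y j|)) ^ 3 with hBnd
  let box : Set (ℤ × ℤ × ℤ × ℤ) := Set.Icc (-Bnd) Bnd ×ˢ Set.Icc (-Bnd) Bnd ×ˢ Set.Icc (-Bnd) Bnd ×ˢ Set.Icc (-Bnd) Bnd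
  have hbox : box.Finite := (Set.finite_Icc _ _).prod ((Set.finite_Icc _ _).prod ((Set.finite_Icc _ _).prod (Set.finite_Icc _ _)))
  let ent : SL(2, ℤ) → ℤ × ℤ × ℤ × ℤ := fun A ↦ (A 0 0, A 0 1, A 1 0, A 1 1)
  have hent : Function.Injective ent := by
    intro A B h
    simp only [ent, Prod.mk.injEq] at h
    ext i j; fin_cases i <;> fin_cases j
    · exact h.1
    · exact h.2.1
    · exact h.2.2.1
    · exact h.2.2.2
  have hfin : ((fun A' : SL(2, ℤ) ↦ g₀ * A') '' (ent ⁻¹' box)).Finite := (hbox.preimage hent.injOn).image _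
  apply hfin.subset
  intro A hA
  rw [Set.mem_setOf_eq] at hA
  refine ⟨g₀⁻¹ * A, ?_, by simp only [mul_inv_cancel_left]⟩
  -- the flag `A' = g₀⁻¹ A`
  set A' : SL(2, ℤ) := g₀⁻¹ * A with hA'
  have hdet1 : A' 0 0 * A' 1 1 - A' 0 1 * A' 1 0 = 1 := by
    have := Matrix.det_fin_two A'.1; rw [A'.2] at this; linear_combination -this
  set s : ℕ → ℤ := fun j ↦ x j * A' 1 0 - y j * A' 0 0 with hs
  set t : ℕ → ℤ := fun j ↦ x j * A' 1 1 - y j * A' 0 1 with ht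
  set Φ : ℕ → ℕ → ℤ := fun i k ↦ if (0 < (-(s k)) * s i ∨ ((-(s k)) * s i = 0 ∧ (0 < (-(s k) + 2 * -(t k)) * (s i + 2 * t i) ∨
        ((-(s k) + 2 * -(t k)) * (s i + 2 * t i) = 0 ∧ 0 < (-(s k)) * t i + (-(t k)) * s i)))) then (1 : ℤ) else 0 with hΦ
  -- (i) the list sum is `Σ_{j<m} Φ(j, j+1)`
  have hsum : ((P.map fun f ↦ g₀ * f).map fun f ↦ (if (0 < (f⁻¹ * A) 0 0 * (f⁻¹ * A) 1 0 ∨ 0 < (f⁻¹ * A) 0 1 * (f⁻¹ * A) 1 1 ∨ 0 < ((f⁻¹ * A) 0 0 + (f⁻¹ * A) 0 1) * ((f⁻¹ * A) 1 0 + (f⁻¹ * A) 1 1)) then (1 : ℤ) else 0)).sum =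
      ∑ j ∈ Finset.range m, Φ j (j + 1) := by
    rw [List.map_map]
    conv_lhs => rw [← List.ofFn_getElem (xs := P), List.map_ofFn, List.sum_ofFn]
    rw [← hlen, ← Fin.sum_univ_eq_sum_range (fun j ↦ Φ j (j + 1))]
    refine Finset.sum_congr rfl fun j _ ↦ ?_
    simp only [Function.comp_apply]
    have hfA : (g₀ * P[(j : ℕ)])⁻¹ * A = (P[(j : ℕ)])⁻¹ * A' := by rw [hA', mul_inv_rev, mul_assoc]
    rw [hfA]
    obtain ⟨e00, e01, e10, e11⟩ := inv_edge_mul_entries (P[(j : ℕ)]) A' (x j) (x (j + 1)) (y j) (y (j + 1)) (hget j j.2)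
    rw [← flagSide_coe_eq_side, e00, e01, e10, e11]
  -- (ii) the long edge: `adj(C) A = (−d s_m, −d t_m; u s_0, u t_0)`
  have hadj : ((g₀ : Matrix (Fin 2) (Fin 2) ℤ) * !![u, v; 0, w]).adjugate * (A : Matrix (Fin 2) (Fin 2) ℤ) =
      !![w, -v; 0, u] * (A' : Matrix (Fin 2) (Fin 2) ℤ) := by
    rw [Matrix.adjugate_mul_distrib, Matrix.adjugate_fin_two_of, neg_zero, ← Matrix.SpecialLinearGroup.coe_inv, Matrix.mul_assoc,
      ← Matrix.SpecialLinearGroup.coe_mul]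
  have l00 : (!![w, -v; 0, u] * (A' : Matrix (Fin 2) (Fin 2) ℤ)) 0 0 = d * (-(s m)) := by
    rw [Matrix.mul_apply, Fin.sum_univ_two, hs, hvd, hwd]; simp; ring
  have l01 : (!![w, -v; 0, u] * (A' : Matrix (Fin 2) (Fin 2) ℤ)) 0 1 = d * (-(t m)) := by
    rw [Matrix.mul_apply, Fin.sum_univ_two, ht, hvd, hwd]; simp; ring
  have l10 : (!![w, -v; 0, u] * (A' : Matrix (Fin 2) (Fin 2) ℤ)) 1 0 = u * (s 0) := by
    show _ = u * (x 0 * A' 1 0 - y 0 * A' 0 0)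
    rw [hx0, hy0, Matrix.mul_apply, Fin.sum_univ_two]; simp
  have l11 : (!![w, -v; 0, u] * (A' : Matrix (Fin 2) (Fin 2) ℤ)) 1 1 = u * (t 0) := by
    show _ = u * (x 0 * A' 1 1 - y 0 * A' 0 1)
    rw [hx0, hy0, Matrix.mul_apply, Fin.sum_univ_two]; simp
  have hlong : (if (0 < (((g₀ : Matrix (Fin 2) (Fin 2) ℤ) * !![u, v; 0, w]).adjugate * (A : Matrix (Fin 2) (Fin 2) ℤ)) 0 0 * (((g₀ : Matrix (Fin 2) (Fin 2) ℤ) * !![u, v; 0, w]).adjugate * (A : Matrix (Fin 2) (Fin 2) ℤ)) 1 0 ∨ ((((g₀ : Matrix (Fin 2) (Fin 2) ℤ) * !![u, v; 0, w]).adjugate * (A : Matrix (Fin 2) (Fin 2) ℤ)) 0 0 * (((g₀ : Matrix (Fin 2) (Fin 2) ℤ) * !![u, v; 0, w]).adjugate * (A : Matrix (Fin 2) (Fin 2) ℤ)) 1 0 = 0 ∧ (0 < ((((g₀ : Matrix (Fin 2) (Fin 2) ℤ) * !![u, v; 0, w]).adjugate * (A : Matrix (Fin 2) (Fin 2) ℤ))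 0 0 + 2 * (((g₀ : Matrix (Fin 2) (Fin 2) ℤ) * !![u, v; 0, w]).adjugate * (A : Matrix (Fin 2) (Fin 2) ℤ)) 0 1) * ((((g₀ : Matrix (Fin 2) (Fin 2) ℤ) * !![u, v; 0, w]).adjugate * (A : Matrix (Fin 2) (Fin 2) ℤ)) 1 0 + 2 * (((g₀ : Matrix (Fin 2) (Fin 2) ℤ) * !![u, v; 0, w]).adjugate * (A : Matrix (Fin 2) (Fin 2) ℤ)) 1 1) ∨
          (((((g₀ : Matrix (Fin 2) (Fin 2) ℤ) * !![u, v; 0, w]).adjugate * (A : Matrix (Fin 2) (Fin 2) ℤ)) 0 0 + 2 * (((g₀ : Matrix (Fin 2) (Fin 2) ℤ) * !![u, v; 0, w]).adjugate * (A : Matrix (Fin 2) (Fin 2) ℤ)) 0 1) * ((((g₀ : Matrix (Fin 2) (Fin 2) ℤ) * !![u, v; 0, w]).adjugate * (A : Matrix (Fin 2) (Fin 2) ℤ)) 1 0 + 2 * (((g₀ : Matrix (Fin 2) (Fin 2) ℤ) * !![u, v; 0, w]).adjugate * (A : Matrix (Fin 2) (Fin 2) ℤ)) 1 1) = 0 ∧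 0 < (((g₀ : Matrix (Fin 2) (Fin 2) ℤ) * !![u, v; 0, w]).adjugate * (A : Matrix (Fin 2) (Fin 2) ℤ)) 0 0 * (((g₀ : Matrix (Fin 2) (Fin 2) ℤ) * !![u, v; 0, w]).adjugate * (A : Matrix (Fin 2) (Fin 2) ℤ)) 1 1 + (((g₀ : Matrix (Fin 2) (Fin 2) ℤ) * !![u, v; 0, w]).adjugate * (A : Matrix (Fin 2) (Fin 2) ℤ)) 0 1 * (((g₀ : Matrix (Fin 2) (Fin 2) ℤ) * !![u, v; 0, w]).adjugate * (A : Matrix (Fin 2) (Fin 2) ℤ)) 1 0)))) then (1 : ℤ) else 0) = Φ 0 m := by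
    rw [hadj, l00, l01, l10, l11, flagSide_rowScale d u (-(s m)) (-(t m)) (s 0) (t 0) hd hu]
  -- (iii) the box
  rw [hsum, hlong, sub_ne_zero] at hA
  obtain ⟨ba, bb, bc, be⟩ := jordan_box m x y hx0 hy0 hm hypos hdet (A' 0 0) (A' 0 1) (A' 1 0) (A' 1 1) hdet1 s t
    (fun j ↦ rfl) (fun j ↦ rfl) Φ (fun i k ↦ rfl) hA
  simp only [Set.mem_preimage, box, ent, Set.mem_prod, Set.mem_Icc, abs_le] at ba bb bc be ⊢
  exact ⟨ba, bb, bc, be⟩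

end KappaFinite

end Summit.BirchSwinnertonDyer.BirchSwinnertonDyer.Theorems.ThetaLayerLambdaCongruenceAtTwo

end
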